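import Literature.Analysis.FunctionSpaces.AgmonExteriorCone
import Literature.Geometry.Lorentzian.KerrPointwiseDecayHierarchy
import HarnessLib

/-!
# Agmon's inequality on the Kerr–Schild slices: the Gagliardo–Nirenberg hypothesis (GN) of the
# assembly of DRSR Corollary 3.1 (30), proved

(statement group **gr.S24**; namespace `Literature.Geometry.Lorentzian.Kerr`, glue in
`Literature.Geometry.Lorentzian`)

`KerrPointwiseDecayHierarchy.lean` proves the pointwise decay rate `τ^{-3/2+δ}` of
Dafermos–Rodnianski–Shlapentokh-Rothman (arXiv:1402.7034 = Ann. of Math. 183 (2016), "DRSR",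
Cor. 3.1, estimate (30)) from two explicit hypotheses: the energy-decay estimates (D) through the
hyperboloidal leaves `Σ̃_τ(h♯_{R₁})` (DRSR Cor. 3.1, estimates 1–3; Moschidis arXiv:1509.08489,
Thms. 7.1, 8.1, 9.1) and the interpolation inequality (GN) on the slice region
`S = {y ∈ E3 : r(0, y) > r₊}` (Moschidis, Lemma 9.10 for `d = 3`, in Cartesian form: Agmon's
inequality `Φ(y)² ≤ C (‖DΦ‖_{L²(S)} ‖D²Φ‖_{L²(S)} + ‖D²Φ‖²_{L²(S)})` for smooth `Φ` on `S` with
`‖y‖|Φ|`, `‖y‖‖DΦ‖` bounded). This file **proves (GN)** — in the sharper, scale-invariant form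
without the `‖D²Φ‖²` term and with an absolute constant — and records the assembly with (D) as its
only remaining hypothesis:

* `Kerr.one_le_horizonQuad_of_mem_slice`, `Kerr.mem_slice_of_one_lt_horizonQuad`: for `r₀ > 0` the
  slice `Kerr.slice a r₀ = {r(0, ·) > r₀}` is the exterior `{q > 1}` of the solid ellipsoid
  `q(y) = (y₀² + y₁²)/(r₀² + a²) + y₂²/r₀² ≤ 1` (O'Neill 1995, Ch. 2, §2.1: `{r = c}` is the confocal
  ellipsoid `(x² + y²)/(c² + a²) + z²/c² = 1`; here from the defining quartic of the Kerr–Schild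
  radius, `Kerr.radius_sq`);
* `Kerr.exists_cone_subset_slice`: the hole being convex, every `x ∈ S` is the vertex of an open
  cone `{x + s z : s > 0, ‖z − n‖ < ½}` contained in `S` (`n = ∇q(x)/‖∇q(x)‖`:
  `q(x + w) = q(x) + ⟨∇q(x), w⟩ + q(w) > 1` when `⟨∇q(x), w⟩ > 0`);
* `Kerr.gagliardoNirenberg_slice` (**proved**): the statement (GN) of
  `Kerr.drsr_corollary_3_1_scri_pointwise_decay_of_leafEnergy_decay`, literally, with
  `C = 54 / vol(B(0, ½))`, from the cone-condition Agmon inequality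
  `Literature.Analysis.FunctionSpaces.sq_le_sqrt_mul_sqrt_of_cone` (ray averaging and the radial
  Hardy inequality with the favourable boundary sign; no extension across `∂S`, hence no
  lower-order or collar terms);
* `Kerr.drsr_corollary_3_1_scri_pointwise_decay_of_leafEnergy_decay'` and
  `Literature.Geometry.Lorentzian.drsr_wave_pointwise_decay_kerr_of_leafEnergy_decay'`
  (**proved**): (D) alone implies the leaf form of (30) for `Σ̃_τ(h♯_{R₁})` (written out as the
  conclusion; formerly the named fact `Kerr.drsr_corollary_3_1_scri_pointwise_decay`, merged into
  the gr.S24 fact, to which it is equivalent, `KerrPointwiseDecay.lean`) and the named fact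
  `Literature.Geometry.Lorentzian.drsr_wave_pointwise_decay_kerr` (`KerrWaveDecay.lean`, gr.S24).

What remains hypothetical in the pointwise-decay chain is exactly (D): the decay of the first- and
second-order energies through the leaves and the finiteness of the radiation field (DRSR Cor. 3.1,
estimates 1–3 = Thm. 3.1 + the Dafermos–Rodnianski `r^p` hierarchy), i.e. the deep part of DRSR.
No named facts are introduced here.

## References

* M. Dafermos, I. Rodnianski, Y. Shlapentokh-Rothman, *Decay for solutions of the wave equation on
  Kerr exterior spacetimes III: the full subextremal case `|a| < M`*, Ann. of Math. 183 (2016),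
  arXiv:1402.7034, §3.3, Cor. 3.1 (30) (key `DafermosRodnianskiShlapentokhrothman2014`).
* G. Moschidis, *The `r^p`-weighted energy method of Dafermos and Rodnianski in general
  asymptotically flat spacetimes and applications*, Ann. PDE 2 (2016), arXiv:1509.08489, §9.4,
  Lemma 9.10 (key `Moschidis2016`).
* B. O'Neill, *The geometry of Kerr black holes*, A K Peters (1995), Ch. 2, §2.1 (key `ONeill1995`).
* C. Foias, O. Manley, R. Rosa, R. Temam, *Navier–Stokes equations and turbulence*, CUP (2001),
  Ch. II, (A.29) (key `FoiasManleyRosaTemam2001`).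
-/

noncomputable section

open Set Filter MeasureTheory Metric Module
open scoped Topology ENNReal ContDiff RealInnerProductSpace

namespace Literature.Geometry.Lorentzian

namespace Kerr

/-! ### The slice is the exterior of a solid ellipsoid -/

/-- The square of the Kerr–Schild radius on the slice `{t* = 0}` in terms of `y ∈ E3`:
`r(0, y)² = ((‖y‖² − a²) + √((‖y‖² − a²)² + 4a² y₂²))/2` (Visser arXiv:0706.0622, (35)). [cite: arXiv07060622, (35)] -/
theorem radius_ofTimeSpace_zero_sq (a : ℝ) (y : E3) :
    radius a (E4.ofTimeSpace 0 y) ^ 2 =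
      ((‖y‖ ^ 2 - a ^ 2) + √((‖y‖ ^ 2 - a ^ 2) ^ 2 + 4 * a ^ 2 * y 2 ^ 2)) / 2 := by
  have h3 : (E4.ofTimeSpace 0 y) 3 = y 2 := E4.ofTimeSpace_apply_succ 0 y 2
  rw [radius_sq, E4.spatialNorm_ofTimeSpace, h3]

/-- **On the slice `{r(0, ·) > r₀}` (`r₀ > 0`) the horizon quadratic form is at least one:**
`(y₀² + y₁²)/(r₀² + a²) + y₂²/r₀² ≥ 1`. With `t = r²` the larger root of `t² − bt − a²y₂²`
(`b = ‖y‖² − a²`) one has `t > r₀²`, `t ≥ b`, and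
`r₀⁴ − b r₀² − a² y₂² = (r₀² − t)(r₀² + t − b) < 0`, which is the claim cleared of denominators.
O'Neill 1995, Ch. 2, §2.1 (the level sets `{r = c}` are the confocal ellipsoids
`(x² + y²)/(c² + a²) + z²/c² = 1`). [cite: ONeill1995, Ch. 2 §2.1] -/
theorem one_le_horizonQuad_of_mem_slice {a r₀ : ℝ} (hr₀ : 0 < r₀) {y : E3} (hy : y ∈ slice a r₀) :
    1 ≤ (y 0 ^ 2 + y 1 ^ 2) / (r₀ ^ 2 + a ^ 2) + y 2 ^ 2 / r₀ ^ 2 := by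
  have hA : 0 < r₀ ^ 2 + a ^ 2 := by positivity
  have hB : 0 < r₀ ^ 2 := by positivity
  rw [mem_slice, max_eq_left hr₀.le] at hy
  have hrsq := radius_ofTimeSpace_zero_sq a y
  have hny : ‖y‖ ^ 2 = y 0 ^ 2 + y 1 ^ 2 + y 2 ^ 2 := E3.norm_sq y
  obtain ⟨r, hr⟩ : ∃ r : ℝ, radius a (E4.ofTimeSpace 0 y) = r := ⟨_, rfl⟩
  rw [hr] at hy hrsq
  obtain ⟨b, hb⟩ : ∃ b : ℝ, ‖y‖ ^ 2 - a ^ 2 = b := ⟨_, rfl⟩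
  rw [hb] at hrsq
  obtain ⟨D, hD⟩ : ∃ D : ℝ, b ^ 2 + 4 * a ^ 2 * y 2 ^ 2 = D := ⟨_, rfl⟩
  rw [hD] at hrsq
  obtain ⟨t, ht⟩ : ∃ t : ℝ, r ^ 2 = t := ⟨_, rfl⟩
  rw [ht] at hrsq
  -- `hrsq : t = (b + √D) / 2`
  have hD0 : 0 ≤ D := by rw [← hD]; positivity
  have hsD : √D ^ 2 = D := Real.sq_sqrt hD0
  have hDb : |b| ≤ √D := by
    rw [← Real.sqrt_sq_eq_abs]
    exact Real.sqrt_le_sqrt (by rw [← hD]; nlinarith [sq_nonneg (a * y 2)])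
  have htb : b ≤ t := by
    rw [hrsq]
    linarith [le_abs_self b]
  have hquart : t ^ 2 - b * t - a ^ 2 * y 2 ^ 2 = 0 := by
    rw [hrsq]
    linear_combination (1 / 4 : ℝ) * hsD - (1 / 4 : ℝ) * hD
  have hlt : r₀ ^ 2 < t := by
    rw [← ht]
    exact pow_lt_pow_left₀ hy hr₀.le two_ne_zero
  have hneg : r₀ ^ 4 - b * r₀ ^ 2 - a ^ 2 * y 2 ^ 2 < 0 := by
    have h1 : r₀ ^ 4 - b * r₀ ^ 2 - a ^ 2 * y 2 ^ 2 = (r₀ ^ 2 - t) * (r₀ ^ 2 + t - b) := by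
      linear_combination hquart
    rw [h1]
    exact mul_neg_of_neg_of_pos (by linarith) (by linarith)
  rw [div_add_div _ _ hA.ne' hB.ne', le_div_iff₀ (by positivity)]
  rw [← hb, hny] at hneg
  nlinarith [hneg]

/-- **Points where the horizon quadratic form exceeds one lie in the slice:** for `r₀ > 0`,
`(y₀² + y₁²)/(r₀² + a²) + y₂²/r₀² > 1` implies `r(0, y) > r₀`. Indeed the hypothesis says
`p(r₀²) < 0` for `p(t) = t² − bt − a²y₂²`, i.e. `(2r₀² − b)² < b² + 4a²y₂²`, so `r₀²` is below the
larger root `r² = (b + √(b² + 4a²y₂²))/2`. O'Neill 1995, Ch. 2, §2.1. [cite: ONeill1995, Ch. 2 §2.1] -/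
theorem mem_slice_of_one_lt_horizonQuad {a r₀ : ℝ} (hr₀ : 0 < r₀) {y : E3}
    (hq : 1 < (y 0 ^ 2 + y 1 ^ 2) / (r₀ ^ 2 + a ^ 2) + y 2 ^ 2 / r₀ ^ 2) : y ∈ slice a r₀ := by
  have hA : 0 < r₀ ^ 2 + a ^ 2 := by positivity
  have hB : 0 < r₀ ^ 2 := by positivity
  rw [mem_slice, max_eq_left hr₀.le]
  have hrsq := radius_ofTimeSpace_zero_sq a y
  have hny : ‖y‖ ^ 2 = y 0 ^ 2 + y 1 ^ 2 + y 2 ^ 2 := E3.norm_sq y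
  have hr0 : 0 ≤ radius a (E4.ofTimeSpace 0 y) := radius_nonneg a _
  obtain ⟨r, hr⟩ : ∃ r : ℝ, radius a (E4.ofTimeSpace 0 y) = r := ⟨_, rfl⟩
  rw [hr] at hrsq hr0 ⊢
  obtain ⟨b, hb⟩ : ∃ b : ℝ, ‖y‖ ^ 2 - a ^ 2 = b := ⟨_, rfl⟩
  rw [hb] at hrsq
  obtain ⟨D, hD⟩ : ∃ D : ℝ, b ^ 2 + 4 * a ^ 2 * y 2 ^ 2 = D := ⟨_, rfl⟩
  rw [hD] at hrsq
  -- `hrsq : r ^ 2 = (b + √D) / 2`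
  rw [div_add_div _ _ hA.ne' hB.ne', one_lt_div (by positivity)] at hq
  -- `p(r₀²) < 0`
  have hneg : r₀ ^ 4 - b * r₀ ^ 2 - a ^ 2 * y 2 ^ 2 < 0 := by
    rw [← hb, hny]
    nlinarith [hq]
  -- hence `2r₀² − b < √D`, i.e. `r₀² < r²`
  have hlt : 2 * r₀ ^ 2 - b < √D := by
    apply Real.lt_sqrt_of_sq_lt
    rw [← hD]
    nlinarith [hneg]
  have hsq : r₀ ^ 2 < r ^ 2 := by
    rw [hrsq]
    linarith
  exact lt_of_pow_lt_pow_left₀ 2 hr0 hsq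

/-- **The cone condition of the slice.** For `r₀ > 0` and `x ∈ Kerr.slice a r₀` there is a unit
vector `n` (the normalised gradient of the horizon quadratic form `q` at `x`) such that the open
cone `{x + s z : s > 0, ‖z − n‖ < ½}` lies in the slice: `q(x + w) = q(x) + 2⟨g, w⟩ + q(w)` with
`g = (x₀/(r₀² + a²), x₁/(r₀² + a²), x₂/r₀²)`, and `⟨g, z⟩ ≥ ‖g‖ − ‖g‖‖z − n‖ > ‖g‖/2 > 0` for
`‖z − n‖ < ½` — the hole `{q ≤ 1}` is a (convex) solid ellipsoid, O'Neill 1995, Ch. 2, §2.1. [cite: ONeill1995, Ch. 2 §2.1] -/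
theorem exists_cone_subset_slice {a r₀ : ℝ} (hr₀ : 0 < r₀) {x : E3} (hx : x ∈ slice a r₀) :
    ∃ n : E3, ‖n‖ = 1 ∧ ∀ z ∈ ball n (1 / 2 : ℝ), ∀ s : ℝ, 0 < s → x + s • z ∈ slice a r₀ := by
  have hA : 0 < r₀ ^ 2 + a ^ 2 := by positivity
  have hB : 0 < r₀ ^ 2 := by positivity
  set A : ℝ := r₀ ^ 2 + a ^ 2 with hAdef
  set B : ℝ := r₀ ^ 2 with hBdef
  -- the gradient direction
  set g : E3 := !₂[x 0 / A, x 1 / A, x 2 / B] with hg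
  have hg0 : g 0 = x 0 / A := by simp [hg]
  have hg1 : g 1 = x 1 / A := by simp [hg]
  have hg2 : g 2 = x 2 / B := by simp [hg]
  have hinner : ∀ w : E3, ⟪g, w⟫ = x 0 / A * w 0 + x 1 / A * w 1 + x 2 / B * w 2 := by
    intro w
    rw [← hg0, ← hg1, ← hg2]
    simp only [PiLp.inner_apply, RCLike.inner_apply, conj_trivial, Fin.sum_univ_three]
    ring
  have hq1 : 1 ≤ (x 0 ^ 2 + x 1 ^ 2) / A + x 2 ^ 2 / B := one_le_horizonQuad_of_mem_slice hr₀ hx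
  -- `⟨g, x⟩ = q(x) ≥ 1`, so `g ≠ 0`
  have hgx : ⟪g, x⟫ = (x 0 ^ 2 + x 1 ^ 2) / A + x 2 ^ 2 / B := by
    rw [hinner]
    ring
  have hgpos : 0 < ‖g‖ := by
    have h1 : (1 : ℝ) ≤ ‖g‖ * ‖x‖ := (hq1.trans_eq hgx.symm).trans (real_inner_le_norm g x)
    rcases (norm_nonneg g).eq_or_lt with h | h
    · rw [← h, zero_mul] at h1
      linarith
    · exact h
  refine ⟨‖g‖⁻¹ • g, ?_, ?_⟩
  · rw [norm_smul, norm_inv, norm_norm, inv_mul_cancel₀ hgpos.ne']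
  intro z hz s hs
  have hzn : ‖z - ‖g‖⁻¹ • g‖ < 1 / 2 := by rwa [mem_ball, dist_eq_norm] at hz
  -- `⟨g, z⟩ > ‖g‖/2`
  have hgz : ‖g‖ / 2 < ⟪g, z⟫ := by
    have h1 : ⟪g, z⟫ = ‖g‖ + ⟪g, z - ‖g‖⁻¹ • g⟫ := by
      rw [inner_sub_right, real_inner_smul_right, real_inner_self_eq_norm_sq]
      field_simp
      ring
    have h2 : |⟪g, z - ‖g‖⁻¹ • g⟫| ≤ ‖g‖ * ‖z - ‖g‖⁻¹ • g‖ := abs_real_inner_le_norm _ _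
    have h3 : ‖g‖ * ‖z - ‖g‖⁻¹ • g‖ < ‖g‖ * (1 / 2) := mul_lt_mul_of_pos_left hzn hgpos
    have h4 := neg_abs_le ⟪g, z - ‖g‖⁻¹ • g⟫
    linarith
  -- `q(x + s z) ≥ q(x) + 2 s ⟨g, z⟩ > 1`
  apply mem_slice_of_one_lt_horizonQuad hr₀
  have hexp : ((x + s • z) 0 ^ 2 + (x + s • z) 1 ^ 2) / (r₀ ^ 2 + a ^ 2) +
      (x + s • z) 2 ^ 2 / r₀ ^ 2 =
      ((x 0 ^ 2 + x 1 ^ 2) / A + x 2 ^ 2 / B) + 2 * s * ⟪g, z⟫ +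
        s ^ 2 * ((z 0 ^ 2 + z 1 ^ 2) / A + z 2 ^ 2 / B) := by
    rw [hinner]
    simp only [PiLp.add_apply, PiLp.smul_apply, smul_eq_mul, hAdef, hBdef]
    field_simp
    ring
  rw [hexp]
  have hqz : 0 ≤ s ^ 2 * ((z 0 ^ 2 + z 1 ^ 2) / A + z 2 ^ 2 / B) := by positivity
  have hpos : 0 < s * ⟪g, z⟫ := mul_pos hs (by linarith)
  nlinarith [hpos]

/-! ### (GN): Agmon's inequality on the slices -/

/-- **The Gagliardo–Nirenberg / Agmon inequality on the Kerr–Schild slices (hypothesis (GN) of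
`Kerr.drsr_corollary_3_1_scri_pointwise_decay_of_leafEnergy_decay`), proved.** For subextremal
`(M, a)` there is `C ≥ 0` (namely `54 / vol(B(0, ½))`) such that for every `Φ` smooth on the slice
region `S = {r(0, ·) > r₊} ⊆ E3` with `‖y‖|Φ|`, `‖y‖‖DΦ‖` bounded on `S` and
`I₁ = ∫_S ‖DΦ‖² < ∞`, `I₂ = ∫_S ‖D²Φ‖² < ∞`, at every `y ∈ S`,
`Φ(y)² ≤ C (√I₁ √I₂ + I₂)` (in fact `≤ C √I₁ √I₂`). This is Moschidis' Lemma 9.10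
(arXiv:1509.08489, `d = 3`) on the slices in Cartesian form — Agmon's inequality on the exterior of
the (convex) horizon ellipsoid —, obtained from
`Literature.Analysis.FunctionSpaces.sq_le_sqrt_mul_sqrt_of_cone` and the cone condition
`Kerr.exists_cone_subset_slice`. [cite: Moschidis2016, Lemma 9.10] -/
theorem gagliardoNirenberg_slice :
    ∀ (M a : ℝ), IsSubextremal M a → ∃ C : ℝ, 0 ≤ C ∧
        ∀ Φ : E3 → ℝ, ContDiffOn ℝ ∞ Φ (slice a (rPlus M a) : Set E3) →
          (∃ C₀ : ℝ, ∀ y ∈ (slice a (rPlus M a) : Set E3),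
              ‖y‖ * |Φ y| ≤ C₀ ∧ ‖y‖ * ‖fderiv ℝ Φ y‖ ≤ C₀) →
            (∫⁻ y in (slice a (rPlus M a) : Set E3), ENNReal.ofReal (‖fderiv ℝ Φ y‖ ^ 2)) < ⊤ →
            (∫⁻ y in (slice a (rPlus M a) : Set E3),
                ENNReal.ofReal (‖fderiv ℝ (fderiv ℝ Φ) y‖ ^ 2)) < ⊤ →
              ∀ y ∈ (slice a (rPlus M a) : Set E3),
                (Φ y) ^ 2 ≤ C *
                  (Real.sqrt (∫⁻ y in (slice a (rPlus M a) : Set E3),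
                      ENNReal.ofReal (‖fderiv ℝ Φ y‖ ^ 2)).toReal *
                    Real.sqrt (∫⁻ y in (slice a (rPlus M a) : Set E3),
                      ENNReal.ofReal (‖fderiv ℝ (fderiv ℝ Φ) y‖ ^ 2)).toReal +
                    (∫⁻ y in (slice a (rPlus M a) : Set E3),
                      ENNReal.ofReal (‖fderiv ℝ (fderiv ℝ Φ) y‖ ^ 2)).toReal) := by
  intro M a hMa
  refine ⟨54 / (volume (ball (0 : E3) (1 / 2))).toReal, by positivity, ?_⟩
  intro Φ hΦ hdec h₁ h₂ y hy
  obtain ⟨C₀, hC₀⟩ := hdec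
  have hr : 0 < rPlus M a := hMa.rPlus_pos
  obtain ⟨n, hn, hcone⟩ := exists_cone_subset_slice hr hy
  have hE : finrank ℝ E3 = 3 := finrank_euclideanSpace_fin
  have h := Literature.Analysis.FunctionSpaces.sq_le_sqrt_mul_sqrt_of_cone (volume : Measure E3)
    hE (slice a (rPlus M a)).isOpen hy hn hcone (contDiffOn_infty.1 hΦ 2) hC₀ h₁ h₂
  refine h.trans ?_
  have hI : 0 ≤ (∫⁻ y in (slice a (rPlus M a) : Set E3),
      ENNReal.ofReal (‖fderiv ℝ (fderiv ℝ Φ) y‖ ^ 2)).toReal := ENNReal.toReal_nonneg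
  have hC : 0 ≤ 54 / (volume (ball (0 : E3) (1 / 2))).toReal := by positivity
  nlinarith [mul_nonneg hC hI]

/-- **DRSR Corollary 3.1 (30) for the foliation `Σ̃_τ(h♯_{R₁})` from the energy-decay estimates
(D) alone**: `Kerr.drsr_corollary_3_1_scri_pointwise_decay_of_leafEnergy_decay` with its
hypothesis (GN) discharged by `Kerr.gagliardoNirenberg_slice`; the conclusion is the leaf form of
(30), `sup_{Σ̃_τ(h♯_{R₁}) ∩ {r₊ < r ≤ R}} |ψ| ≤ C τ^{-3/2+δ}` (`τ ≥ 1`, admissible waves with ball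
data), equivalent to the gr.S24 fact `Literature.Geometry.Lorentzian.drsr_wave_pointwise_decay_kerr`
(`KerrPointwiseDecay.lean`). The remaining hypothesis (D) is DRSR
Cor. 3.1, estimates 1–3 (Moschidis Thms. 7.1, 8.1, 9.1), documented in
`KerrPointwiseDecayHierarchy.lean`. [cite: DafermosRodnianskiShlapentokhrothman2014, §3.3 Cor. 3.1 (30); Moschidis2016 §9.4] -/
theorem drsr_corollary_3_1_scri_pointwise_decay_of_leafEnergy_decay'
    (hD : ∀ [Facts] [SliceFacts] (M a : ℝ), IsSubextremal M a →
        ∃ R₀ : ℝ, rPlus M a < R₀ ∧ ∀ R₁ : ℝ, R₀ ≤ R₁ →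
          ∀ ψ : region a (rPlus M a) → ℝ, Literature.Geometry.Lorentzian.IsAdmissibleKerrWave M a ψ →
            HasBallData M a R₁ ψ →
              -- (D1) first-order leaf energy: DRSR Cor. 3.1, first estimate / Moschidis Thm. 8.1
              (∃ C : ℝ, ∀ τ : ℝ, 1 ≤ τ →
                leafGradEnergy M a (scriHeight M a R₁) ψ τ ≤ ENNReal.ofReal (C * τ ^ (-2 : ℝ))) ∧
              -- (D2) second-order leaf energy, improved decay: Cor. 3.1, second estimate /
              -- Moschidis Thm. 9.1, q = 2
              (∀ δ : ℝ, 0 < δ → ∃ C : ℝ, ∀ τ : ℝ, 1 ≤ τ →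
                leafHessEnergy M a (scriHeight M a R₁) ψ τ ≤
                  ENNReal.ofReal (C * τ ^ (-4 + 2 * δ))) ∧
              -- (D3) a priori decay along each leaf: Cor. 3.1, third estimate; radiation field
              (∀ τ : ℝ, 1 ≤ τ → ∃ C₀ : ℝ, ∀ y ∈ (slice a (rPlus M a) : Set E3),
                ‖y‖ * |leafFun M a (scriHeight M a R₁) ψ τ y| ≤ C₀ ∧
                  ‖y‖ * ‖fderiv ℝ (leafFun M a (scriHeight M a R₁) ψ τ) y‖ ≤ C₀)) :
    -- DRSR Cor. 3.1 (30) through the leaves `Σ̃_τ(h♯_{R₁})` (the leaf form; equivalent to the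
    -- gr.S24 fact `drsr_wave_pointwise_decay_kerr`, `KerrPointwiseDecay.lean`)
    ∀ [Facts] [SliceFacts] (M a : ℝ), IsSubextremal M a →
      ∃ R₀ : ℝ, 0 < R₀ ∧ ∀ R₁ : ℝ, R₀ ≤ R₁ →
        ∀ ψ : region a (rPlus M a) → ℝ, Literature.Geometry.Lorentzian.IsAdmissibleKerrWave M a ψ →
          HasBallData M a R₁ ψ → ∀ δ : ℝ, 0 < δ → ∀ R : ℝ, rPlus M a < R →
            ∃ C : ℝ, ∀ τ : ℝ, 1 ≤ τ →
              ∀ (y : E3) (hy : leafPoint (scriHeight M a R₁) τ y ∈ region a (rPlus M a)),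
                radius a (leafPoint (scriHeight M a R₁) τ y) ≤ R →
                  |ψ ⟨leafPoint (scriHeight M a R₁) τ y, hy⟩| ≤ C * τ ^ (-(3 / 2 : ℝ) + δ) :=
  fun M a hMa ↦
    drsr_corollary_3_1_scri_pointwise_decay_of_leafEnergy_decay hD gagliardoNirenberg_slice M a hMa

/-- **DRSR's pointwise decay (coordinate form, the gr.S24 named fact
`Literature.Geometry.Lorentzian.drsr_wave_pointwise_decay_kerr`) from the energy-decay estimates (D)
alone**, the interpolation inequality (GN) being proved in this file
(`Kerr.gagliardoNirenberg_slice`): compose `drsr_wave_pointwise_decay_kerr_of_leafEnergy_decay`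
of `KerrPointwiseDecayHierarchy.lean`. DRSR arXiv:1402.7034, §3.3 Cor. 3.1 (30); Moschidis
arXiv:1509.08489, §9.4. [cite: DafermosRodnianskiShlapentokhrothman2014, Cor. 3.1 (30); Moschidis2016 §9.4] -/
theorem _root_.Literature.Geometry.Lorentzian.drsr_wave_pointwise_decay_kerr_of_leafEnergy_decay'
    (hD : ∀ [Facts] [SliceFacts] (M a : ℝ), IsSubextremal M a →
        ∃ R₀ : ℝ, rPlus M a < R₀ ∧ ∀ R₁ : ℝ, R₀ ≤ R₁ →
          ∀ ψ : region a (rPlus M a) → ℝ, Literature.Geometry.Lorentzian.IsAdmissibleKerrWave M a ψ →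
            HasBallData M a R₁ ψ →
              -- (D1) first-order leaf energy: DRSR Cor. 3.1, first estimate / Moschidis Thm. 8.1
              (∃ C : ℝ, ∀ τ : ℝ, 1 ≤ τ →
                leafGradEnergy M a (scriHeight M a R₁) ψ τ ≤ ENNReal.ofReal (C * τ ^ (-2 : ℝ))) ∧
              -- (D2) second-order leaf energy, improved decay: Cor. 3.1, second estimate /
              -- Moschidis Thm. 9.1, q = 2
              (∀ δ : ℝ, 0 < δ → ∃ C : ℝ, ∀ τ : ℝ, 1 ≤ τ →
                leafHessEnergy M a (scriHeight M a R₁) ψ τ ≤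
                  ENNReal.ofReal (C * τ ^ (-4 + 2 * δ))) ∧
              -- (D3) a priori decay along each leaf: Cor. 3.1, third estimate; radiation field
              (∀ τ : ℝ, 1 ≤ τ → ∃ C₀ : ℝ, ∀ y ∈ (slice a (rPlus M a) : Set E3),
                ‖y‖ * |leafFun M a (scriHeight M a R₁) ψ τ y| ≤ C₀ ∧
                  ‖y‖ * ‖fderiv ℝ (leafFun M a (scriHeight M a R₁) ψ τ) y‖ ≤ C₀)) :
    Literature.Geometry.Lorentzian.drsr_wave_pointwise_decay_kerr :=
  Literature.Geometry.Lorentzian.drsr_wave_pointwise_decay_kerr_of_leafEnergy_decay hD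
    gagliardoNirenberg_slice

end Kerr

end Literature.Geometry.Lorentzian

end
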